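import Mathlib.Analysis.Matrix.Spectrum
import Mathlib.LinearAlgebra.Matrix.Charpoly.Basic
import Literature.NumberTheory.LFunctions.NicolasOmega
import Literature.Geometry.Lorentzian.InverseMeanCurvatureFlowWeakGradient
import Summits.QuantumFields.YangMills.Theorems.AllWindowsColdBoxBoxHighLineChartGaussianTail

/-!
# Two-form Gaussian comparison, part 1: determinants (U5-L5 (iii) T-S5.6′ `SmallFieldInsideFPSharp`, `Cruxes/BoxWindowHighSU2213/TaskU5L5.lean`)
# (planner ym-idea-2 g18 2026-08-29T22:0xZ «dominate e^{−β(W+Φ)} by the two Gaussians with forms Q∓ = (1 ∓ δ)Q ∓ δN; their normaliser ratio is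
# exp(O(δ·(n + Σ_e G(e,e))))»; LINE-20 U5 ⟨stmt-QuantumFields-24336⟩; U5 prep, helper-grade; U5 OPEN)

Width seat `ym-line-sfw-p2-w4` (prover-ym-line-sfw-p2-w4-g29-0), T-S5.6 lineage.  Pure linear algebra on a real symmetric positive definite
matrix `A` (in T-S5.6′: `A = hodgeQ H ⊗ₖ 1₃`) with inverse `G = A⁻¹` and a coercivity constant `κ` (`κ|x|² ≤ xᵀAx`; in T-S5.6′ `κ = (344H²)⁻¹`):

* `det_one_add_smul_eq_prod` — `det(1 + μG) = Π_i (1 + μ·γ_i)` over the eigenvalues `γ_i` of the symmetric `G` (✓`IsHermitian.charpoly_eq` at `−μ⁻¹`);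
* `eigenvalues_inv_nonneg` / `eigenvalues_inv_le` — `0 ≤ γ_i ≤ κ⁻¹` for `G = A⁻¹`;
* `det_one_add_smul_le_exp` — `det(1 + μG) ≤ e^{μ·tr G}` (`μ ≥ 0`); `exp_neg_le_det_one_sub_smul` — `e^{−2μ·tr G} ≤ det(1 − μG)` when `μγ_i ≤ ½`
  (`e^{−2y} ≤ 1 − y` on `[0, ½]` is ✓`Literature.NumberTheory.LFunctions.Nicolas.exp_neg_two_mul_le`, reused by name);
* ★ `det_twoForm_le` — for `0 ≤ δ ≤ κ/4`, `κ ≤ 1`: `0 < det((1−δ)A − δ·1)` and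
  `det((1+δ)A + δ·1) ≤ exp(3δ·N + 5δ·tr A⁻¹) · det((1−δ)A − δ·1)` (`N = |ι|`), via `(1±δ)A ± δ·1 = (1±δ)·A·(1 ± μ_±G)`, `μ_± = δ/(1±δ)`;
* `quadForm_le_twoFormPlus` / `quadForm_le_two_mul_twoFormMinus` — the Loewner facts `A ≤ P₊`, `A ≤ 2P₋`;
* ★ `inv_diag_le_of_quadForm_le` — the variational comparison of diagonals of inverses: `xᵀM′x ≤ xᵀMx ∀x ⇒ (M⁻¹)_pp ≤ (M′⁻¹)_pp`.

Everything proved; no definitions; standard axioms.  HONEST LABEL: a linear-algebra input of the typed task T-S5.6′ (lift L5 of the NEXT rung U5); U5 ⟨24336⟩,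
⟨24004⟩ and the seat's own crux ⟨22884⟩ remain OPEN; nothing here closes a stub; **the Yang–Mills mass gap is NOT proved by this file; no summit is proved by a line.**
-/

set_option autoImplicit false

open Matrix Finset Real

namespace Summit.QuantumFields.YangMills.Theorems.AllWindowsColdBoxBoxHighLine

namespace TwoFormGauss

variable {ι : Type*} [Fintype ι] [DecidableEq ι]

/-! ## `det(1 + μG)` as a product over the spectrum -/

/-- **`det(1 + μ·G) = Π_i (1 + μ·γ_i)`** for a real symmetric `G` with eigenvalues `γ_i`. -/
theorem det_one_add_smul_eq_prod {G : Matrix ι ι ℝ} (hG : G.IsHermitian) (μ : ℝ) :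
    (1 + μ • G).det = ∏ i, (1 + μ * hG.eigenvalues i) := by
  by_cases hμ : μ = 0
  · simp [hμ]
  · have h := Matrix.eval_charpoly G (-μ⁻¹)
    rw [hG.charpoly_eq, Polynomial.eval_prod] at h
    simp only [Polynomial.eval_sub, Polynomial.eval_X, Polynomial.eval_C, RCLike.ofReal_real_eq_id, id_eq] at h
    -- `1 + μG = (−μ)·(scalar(−μ⁻¹) − G)`
    have hM : (1 + μ • G) = (-μ) • (Matrix.scalar ι (-μ⁻¹) - G) := by
      ext i j
      by_cases hij : i = j
      · subst hij
        simp
        have hμμ : μ * μ⁻¹ = 1 := mul_inv_cancel₀ hμ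
        linear_combination -hμμ
      · simp [hij]
    rw [hM, det_smul, ← h, ← Finset.card_univ, ← Finset.prod_const, ← Finset.prod_mul_distrib]
    refine Finset.prod_congr rfl fun i _ => ?_
    have : -μ * -μ⁻¹ = 1 := by rw [neg_mul_neg, mul_inv_cancel₀ hμ]
    calc -μ * (-μ⁻¹ - hG.eigenvalues i) = -μ * -μ⁻¹ + μ * hG.eigenvalues i := by ring
      _ = 1 + μ * hG.eigenvalues i := by rw [this]

/-! ## The spectrum of `G = A⁻¹` -/

/-- The eigenvalues of `A⁻¹` are nonnegative (`A` positive definite). -/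
theorem eigenvalues_inv_nonneg {A : Matrix ι ι ℝ} (hA : A.PosDef) (hG : (A⁻¹).IsHermitian) (i : ι) : 0 ≤ hG.eigenvalues i :=
  (hA.inv.eigenvalues_pos i).le

/-- **`γ_i ≤ κ⁻¹`**: the eigenvalues of `G = A⁻¹` are at most the inverse coercivity constant of `A` (`κ·|x|² ≤ xᵀAx`). -/
theorem eigenvalues_inv_le {A : Matrix ι ι ℝ} (hA : A.PosDef) {κ : ℝ} (hκ : 0 < κ) (hκA : ∀ x : ι → ℝ, κ * (x ⬝ᵥ x) ≤ x ⬝ᵥ (A *ᵥ x))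
    (hG : (A⁻¹).IsHermitian) (i : ι) : hG.eigenvalues i ≤ 1 / κ := by
  set γ : ℝ := hG.eigenvalues i with hγdef
  set v : ι → ℝ := ⇑(hG.eigenvectorBasis i) with hvdef
  have hv : A⁻¹ *ᵥ v = γ • v := by
    have := hG.mulVec_eigenvectorBasis i
    simpa using this
  have hdet : IsUnit A.det := (hA.isUnit).map Matrix.detMonoidHom
  -- `v = A (A⁻¹ v) = γ · A v`
  have hAv : v = γ • (A *ᵥ v) := by
    have h1 : A *ᵥ (A⁻¹ *ᵥ v) = v := by rw [Matrix.mulVec_mulVec, Matrix.mul_nonsing_inv A hdet, Matrix.one_mulVec]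
    rw [hv, Matrix.mulVec_smul] at h1
    exact h1.symm
  -- `v ≠ 0`
  have hv0 : v ≠ 0 := by
    intro h0
    have hne := hG.eigenvectorBasis.orthonormal.ne_zero i
    apply hne
    have : (⇑(hG.eigenvectorBasis i) : ι → ℝ) = 0 := by rw [← hvdef]; exact h0
    exact (WithLp.ofLp_eq_zero (p := 2)).1 this
  have hvv : 0 < v ⬝ᵥ v := by
    have h := (Matrix.dotProduct_star_self_pos_iff (v := v)).2 hv0
    simpa using h
  -- `v·v = γ · vᵀAv ≥ γ κ v·v`
  have hγ0 : 0 ≤ γ := eigenvalues_inv_nonneg hA hG i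
  have hkey : v ⬝ᵥ v = γ * (v ⬝ᵥ (A *ᵥ v)) := by
    nth_rw 1 [hAv]
    rw [smul_dotProduct, smul_eq_mul, dotProduct_comm (A *ᵥ v) v]
  have h2 : γ * (κ * (v ⬝ᵥ v)) ≤ v ⬝ᵥ v := by
    calc γ * (κ * (v ⬝ᵥ v)) ≤ γ * (v ⬝ᵥ (A *ᵥ v)) := mul_le_mul_of_nonneg_left (hκA v) hγ0
      _ = v ⬝ᵥ v := hkey.symm
  -- divide by `κ · v·v > 0`
  have h3 : γ * κ ≤ 1 := by
    by_contra hc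
    push Not at hc
    have : v ⬝ᵥ v < γ * (κ * (v ⬝ᵥ v)) := by nlinarith
    linarith
  rw [le_div_iff₀ hκ]
  exact h3

/-! ## Products over the spectrum -/

/-- **`det(1 + μG) ≤ e^{μ·tr G}`** (`μ ≥ 0`, `G = A⁻¹` with `A` positive definite). -/
theorem det_one_add_smul_le_exp {A : Matrix ι ι ℝ} (hA : A.PosDef) (hG : (A⁻¹).IsHermitian) {μ : ℝ} (hμ : 0 ≤ μ) :
    (1 + μ • A⁻¹).det ≤ Real.exp (μ * (A⁻¹).trace) := by
  rw [det_one_add_smul_eq_prod hG μ, hG.trace_eq_sum_eigenvalues]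
  simp only [RCLike.ofReal_real_eq_id, id_eq]
  rw [Finset.mul_sum, Real.exp_sum]
  refine Finset.prod_le_prod (fun i _ => ?_) (fun i _ => ?_)
  · have := eigenvalues_inv_nonneg hA hG i
    positivity
  · have h := Real.add_one_le_exp (μ * hG.eigenvalues i)
    linarith

/-- **`e^{−2μ·tr G} ≤ det(1 − μG)`** when `0 ≤ μ` and `μ·γ_i ≤ ½` for all eigenvalues `γ_i` of `G = A⁻¹`; in particular `det(1 − μG) > 0`. -/
theorem exp_neg_le_det_one_sub_smul {A : Matrix ι ι ℝ} (hA : A.PosDef) (hG : (A⁻¹).IsHermitian) {μ : ℝ} (hμ : 0 ≤ μ)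
    (hhalf : ∀ i, μ * hG.eigenvalues i ≤ 1 / 2) :
    Real.exp (-(2 * μ * (A⁻¹).trace)) ≤ (1 - μ • A⁻¹).det := by
  have h1 : (1 - μ • A⁻¹) = 1 + (-μ) • A⁻¹ := by rw [neg_smul, sub_eq_add_neg]
  rw [h1, det_one_add_smul_eq_prod hG (-μ), hG.trace_eq_sum_eigenvalues]
  simp only [RCLike.ofReal_real_eq_id, id_eq]
  rw [show -(2 * μ * ∑ i, hG.eigenvalues i) = ∑ i, -(2 * (μ * hG.eigenvalues i)) by rw [Finset.mul_sum, ← Finset.sum_neg_distrib]; ring_nf,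
    Real.exp_sum]
  refine Finset.prod_le_prod (fun i _ => (Real.exp_pos _).le) (fun i _ => ?_)
  have h0 : 0 ≤ μ * hG.eigenvalues i := mul_nonneg hμ (eigenvalues_inv_nonneg hA hG i)
  have := Literature.NumberTheory.LFunctions.Nicolas.exp_neg_two_mul_le h0 (hhalf i)
  linarith

/-! ## The two-form determinant ratio -/

/-- `(1+δ)A + δ·1 = (1+δ)·(A·(1 + μ₊·A⁻¹))` with `μ₊ = δ/(1+δ)`, and `(1−δ)A − δ·1 = (1−δ)·(A·(1 − μ₋·A⁻¹))` with `μ₋ = δ/(1−δ)`. -/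
theorem twoForm_factor {A : Matrix ι ι ℝ} (hA : A.PosDef) {c d : ℝ} (hc : c ≠ 0) :
    c • A + d • (1 : Matrix ι ι ℝ) = c • (A * (1 + (d / c) • A⁻¹)) := by
  have hdet : IsUnit A.det := (hA.isUnit).map Matrix.detMonoidHom
  rw [Matrix.mul_add, Matrix.mul_one, Matrix.mul_smul, Matrix.mul_nonsing_inv A hdet, smul_add, smul_smul,
    mul_div_cancel₀ d hc]

/-- ★ **The two-form determinant ratio.**  For a real positive definite `A` with `κ|x|² ≤ xᵀAx` (`0 < κ ≤ 1`) and `0 ≤ δ ≤ κ/4`: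
`0 < det((1−δ)A − δ·1)` and `det((1+δ)A + δ·1) ≤ exp(3δ·N + 5δ·tr A⁻¹)·det((1−δ)A − δ·1)`. -/
theorem det_twoForm_le {A : Matrix ι ι ℝ} (hA : A.PosDef) {κ δ : ℝ} (hκ : 0 < κ) (hκ1 : κ ≤ 1)
    (hκA : ∀ x : ι → ℝ, κ * (x ⬝ᵥ x) ≤ x ⬝ᵥ (A *ᵥ x)) (hδ0 : 0 ≤ δ) (hδ : δ ≤ κ / 4) :
    0 < ((1 - δ) • A - δ • (1 : Matrix ι ι ℝ)).det ∧
      ((1 + δ) • A + δ • (1 : Matrix ι ι ℝ)).det ≤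
        Real.exp (3 * δ * Fintype.card ι + 5 * δ * (A⁻¹).trace) * ((1 - δ) • A - δ • (1 : Matrix ι ι ℝ)).det := by
  have hG : (A⁻¹).IsHermitian := hA.inv.isHermitian
  have hδ14 : δ ≤ 1 / 4 := hδ.trans (by linarith)
  have h1mδ : 0 < 1 - δ := by linarith
  have h1pδ : 0 < 1 + δ := by linarith
  -- the two `μ`'s
  set μp : ℝ := δ / (1 + δ) with hμp
  set μm : ℝ := δ / (1 - δ) with hμm
  have hμp0 : 0 ≤ μp := div_nonneg hδ0 h1pδ.le
  have hμm0 : 0 ≤ μm := div_nonneg hδ0 h1mδ.le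
  have hμpδ : μp ≤ δ := by rw [hμp, div_le_iff₀ h1pδ]; nlinarith
  have hμmδ : μm ≤ 2 * δ := by rw [hμm, div_le_iff₀ h1mδ]; nlinarith
  -- the factorizations
  have hdetA : 0 < A.det := hA.det_pos
  have hplus : (1 + δ) • A + δ • (1 : Matrix ι ι ℝ) = (1 + δ) • (A * (1 + μp • A⁻¹)) := twoForm_factor hA h1pδ.ne'
  have hminus : (1 - δ) • A - δ • (1 : Matrix ι ι ℝ) = (1 - δ) • (A * (1 - μm • A⁻¹)) := by
    have h := twoForm_factor hA (d := -δ) h1mδ.ne'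
    rw [neg_smul, ← sub_eq_add_neg, neg_div, neg_smul, ← sub_eq_add_neg] at h
    exact h
  -- spectrum of `G`: `μm·γ_i ≤ ½`
  have hγle : ∀ i, hG.eigenvalues i ≤ 1 / κ := eigenvalues_inv_le hA hκ hκA hG
  have hhalf : ∀ i, μm * hG.eigenvalues i ≤ 1 / 2 := by
    intro i
    have h0 := eigenvalues_inv_nonneg hA hG i
    calc μm * hG.eigenvalues i ≤ (2 * δ) * (1 / κ) := mul_le_mul hμmδ (hγle i) h0 (by linarith)
      _ ≤ 1 / 2 := by
          rw [mul_one_div, div_le_iff₀ hκ]; linarith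
  have htr0 : 0 ≤ (A⁻¹).trace := by
    rw [hG.trace_eq_sum_eigenvalues]
    simp only [RCLike.ofReal_real_eq_id, id_eq]
    exact Finset.sum_nonneg fun i _ => eigenvalues_inv_nonneg hA hG i
  -- the two determinant bounds
  have hup := det_one_add_smul_le_exp hA hG hμp0
  have hlow := exp_neg_le_det_one_sub_smul hA hG hμm0 hhalf
  have hlowpos : 0 < (1 - μm • A⁻¹).det := lt_of_lt_of_le (Real.exp_pos _) hlow
  set N := Fintype.card ι with hN
  have hdm : ((1 - δ) • A - δ • (1 : Matrix ι ι ℝ)).det = (1 - δ) ^ N * A.det * (1 - μm • A⁻¹).det := by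
    rw [hminus, det_smul, det_mul, hN]; ring
  have hdp : ((1 + δ) • A + δ • (1 : Matrix ι ι ℝ)).det = (1 + δ) ^ N * A.det * (1 + μp • A⁻¹).det := by
    rw [hplus, det_smul, det_mul, hN]; ring
  have hmpos : 0 < ((1 - δ) • A - δ • (1 : Matrix ι ι ℝ)).det := by
    rw [hdm]; exact mul_pos (mul_pos (pow_pos h1mδ N) hdetA) hlowpos
  have hupnn : 0 ≤ (1 + μp • A⁻¹).det := by
    rw [det_one_add_smul_eq_prod hG]
    exact Finset.prod_nonneg fun i _ => by
      have := eigenvalues_inv_nonneg hA hG i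
      positivity
  refine ⟨hmpos, ?_⟩
  -- `(1+δ)^N ≤ e^{δN}`, `(1−δ)^{-N} ≤ e^{2δN}`: together `(1+δ)^N ≤ e^{3δN} (1−δ)^N`
  have hpow : (1 + δ) ^ N ≤ Real.exp (3 * δ * N) * (1 - δ) ^ N := by
    have h1 : 1 + δ ≤ Real.exp (3 * δ) * (1 - δ) := by
      have ha : 1 + δ ≤ Real.exp δ := by linarith [Real.add_one_le_exp δ]
      have hb : Real.exp (-(2 * δ)) ≤ 1 - δ := Literature.NumberTheory.LFunctions.Nicolas.exp_neg_two_mul_le hδ0 (by linarith)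
      have hc : Real.exp δ = Real.exp (3 * δ) * Real.exp (-(2 * δ)) := by rw [← Real.exp_add]; ring_nf
      calc 1 + δ ≤ Real.exp δ := ha
        _ = Real.exp (3 * δ) * Real.exp (-(2 * δ)) := hc
        _ ≤ Real.exp (3 * δ) * (1 - δ) := mul_le_mul_of_nonneg_left hb (Real.exp_pos _).le
    calc (1 + δ) ^ N ≤ (Real.exp (3 * δ) * (1 - δ)) ^ N := pow_le_pow_left₀ h1pδ.le h1 N
      _ = Real.exp (3 * δ * N) * (1 - δ) ^ N := by rw [mul_pow, ← Real.exp_nat_mul]; ring_nf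
  -- `det(1 + μp G) ≤ e^{δ tr} ` and `det(1 − μm G) ≥ e^{−4δ tr}` ⇒ ratio ≤ e^{5δ tr}
  have hup' : (1 + μp • A⁻¹).det ≤ Real.exp (5 * δ * (A⁻¹).trace) * (1 - μm • A⁻¹).det := by
    have h1 : Real.exp (μp * (A⁻¹).trace) ≤ Real.exp (δ * (A⁻¹).trace) :=
      Real.exp_le_exp.2 (mul_le_mul_of_nonneg_right hμpδ htr0)
    have h2 : Real.exp (-(4 * δ * (A⁻¹).trace)) ≤ Real.exp (-(2 * μm * (A⁻¹).trace)) :=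
      Real.exp_le_exp.2 (by nlinarith [mul_le_mul_of_nonneg_right hμmδ htr0])
    have h3 : Real.exp (δ * (A⁻¹).trace) = Real.exp (5 * δ * (A⁻¹).trace) * Real.exp (-(4 * δ * (A⁻¹).trace)) := by
      rw [← Real.exp_add]; ring_nf
    calc (1 + μp • A⁻¹).det ≤ Real.exp (μp * (A⁻¹).trace) := hup
      _ ≤ Real.exp (δ * (A⁻¹).trace) := h1
      _ = Real.exp (5 * δ * (A⁻¹).trace) * Real.exp (-(4 * δ * (A⁻¹).trace)) := h3
      _ ≤ Real.exp (5 * δ * (A⁻¹).trace) * (1 - μm • A⁻¹).det :=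
          mul_le_mul_of_nonneg_left (h2.trans hlow) (Real.exp_pos _).le
  -- assemble
  rw [hdp, hdm, show 3 * δ * (N : ℝ) + 5 * δ * (A⁻¹).trace = 3 * δ * N + 5 * δ * (A⁻¹).trace from rfl, Real.exp_add]
  calc (1 + δ) ^ N * A.det * (1 + μp • A⁻¹).det
      ≤ (Real.exp (3 * δ * N) * (1 - δ) ^ N) * A.det * (Real.exp (5 * δ * (A⁻¹).trace) * (1 - μm • A⁻¹).det) :=
        mul_le_mul (mul_le_mul_of_nonneg_right hpow hdetA.le) hup' hupnn
          (mul_nonneg (mul_nonneg (Real.exp_pos _).le (pow_nonneg h1mδ.le N)) hdetA.le)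
    _ = Real.exp (3 * δ * N) * Real.exp (5 * δ * (A⁻¹).trace) * ((1 - δ) ^ N * A.det * (1 - μm • A⁻¹).det) := by ring

/-! ## Loewner comparisons and diagonals of inverses -/

/-- `A ≤ (1+δ)A + δ·1` as quadratic forms (`δ ≥ 0`, `A` positive semidefinite on the diagonal pairing). -/
theorem quadForm_le_twoFormPlus {A : Matrix ι ι ℝ} (hA : A.PosDef) {δ : ℝ} (hδ0 : 0 ≤ δ) (x : ι → ℝ) :
    x ⬝ᵥ (A *ᵥ x) ≤ x ⬝ᵥ (((1 + δ) • A + δ • (1 : Matrix ι ι ℝ)) *ᵥ x) := by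
  have hAx : 0 ≤ x ⬝ᵥ (A *ᵥ x) := by
    have := hA.posSemidef.dotProduct_mulVec_nonneg x
    simpa using this
  have hxx : 0 ≤ x ⬝ᵥ x := by
    have := dotProduct_star_self_nonneg x
    simpa using this
  rw [Matrix.add_mulVec, Matrix.smul_mulVec, Matrix.smul_mulVec, Matrix.one_mulVec, dotProduct_add,
    dotProduct_smul, dotProduct_smul, smul_eq_mul, smul_eq_mul]
  nlinarith

/-- `A ≤ 2·((1−δ)A − δ·1)` as quadratic forms when `κ|x|² ≤ xᵀAx`, `κ ≤ 1`, `0 ≤ δ ≤ κ/4`. -/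
theorem quadForm_le_two_mul_twoFormMinus {A : Matrix ι ι ℝ} (hA : A.PosDef) {κ δ : ℝ} (hκ1 : κ ≤ 1)
    (hκA : ∀ x : ι → ℝ, κ * (x ⬝ᵥ x) ≤ x ⬝ᵥ (A *ᵥ x)) (hδ0 : 0 ≤ δ) (hδ : δ ≤ κ / 4) (x : ι → ℝ) :
    x ⬝ᵥ (A *ᵥ x) ≤ 2 * (x ⬝ᵥ (((1 - δ) • A - δ • (1 : Matrix ι ι ℝ)) *ᵥ x)) := by
  have hAx : 0 ≤ x ⬝ᵥ (A *ᵥ x) := by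
    have := hA.posSemidef.dotProduct_mulVec_nonneg x
    simpa using this
  have hxx : 0 ≤ x ⬝ᵥ x := by
    have := dotProduct_star_self_nonneg x
    simpa using this
  have hk := hκA x
  rw [Matrix.sub_mulVec, Matrix.smul_mulVec, Matrix.smul_mulVec, Matrix.one_mulVec, dotProduct_sub,
    dotProduct_smul, dotProduct_smul, smul_eq_mul, smul_eq_mul]
  -- `(1 − 2δ)·xAx − 2δ|x|² ≥ 0 ⟸ (1−2δ)κ ≥ 2δ`
  have hc : 2 * δ ≤ (1 - 2 * δ) * κ := by nlinarith
  nlinarith [mul_le_mul_of_nonneg_left hk (by linarith : (0:ℝ) ≤ 1 - 2 * δ), mul_nonneg hδ0 hxx]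

/-- Completing the square: `2·x·v − vᵀM′v ≤ xᵀM′⁻¹x` for a real positive definite `M′`. -/
theorem two_mul_dotProduct_sub_quadForm_le {M : Matrix ι ι ℝ} (hM : M.PosDef) (x v : ι → ℝ) :
    2 * (x ⬝ᵥ v) - v ⬝ᵥ (M *ᵥ v) ≤ x ⬝ᵥ (M⁻¹ *ᵥ x) := by
  have hdet : IsUnit M.det := (hM.isUnit).map Matrix.detMonoidHom
  set w : ι → ℝ := M⁻¹ *ᵥ x with hw
  have hMw : M *ᵥ w = x := by rw [hw, Matrix.mulVec_mulVec, Matrix.mul_nonsing_inv M hdet, Matrix.one_mulVec]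
  have hsq : 0 ≤ (v - w) ⬝ᵥ (M *ᵥ (v - w)) := by
    have := hM.posSemidef.dotProduct_mulVec_nonneg (v - w)
    simpa using this
  have hsym := Literature.Geometry.Lorentzian.dotProduct_mulVec_comm_of_isHermitian hM.isHermitian
  -- expand
  have hexp : (v - w) ⬝ᵥ (M *ᵥ (v - w)) = v ⬝ᵥ (M *ᵥ v) - 2 * (x ⬝ᵥ v) + x ⬝ᵥ w := by
    rw [Matrix.mulVec_sub, sub_dotProduct, dotProduct_sub, dotProduct_sub, hsym w v, hMw, dotProduct_comm v x,
      dotProduct_comm w x]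
    ring
  linarith

/-- ★ **Diagonal comparison of inverses**: if `xᵀM′x ≤ xᵀMx` for all `x` (both real positive definite), then `(M⁻¹)_pp ≤ (M′⁻¹)_pp`.
(Variational: `(M⁻¹)_pp = 2e_p·v − vᵀMv` at `v = M⁻¹e_p`, `≤ 2e_p·v − vᵀM′v ≤ (M′⁻¹)_pp`.) -/
theorem inv_diag_le_of_quadForm_le {M M' : Matrix ι ι ℝ} (hM : M.PosDef) (hM' : M'.PosDef)
    (h : ∀ x : ι → ℝ, x ⬝ᵥ (M' *ᵥ x) ≤ x ⬝ᵥ (M *ᵥ x)) (p : ι) : M⁻¹ p p ≤ M'⁻¹ p p := by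
  have hdet : IsUnit M.det := (hM.isUnit).map Matrix.detMonoidHom
  set x : ι → ℝ := Pi.single p 1 with hx
  set v : ι → ℝ := M⁻¹ *ᵥ x with hv
  have hMv : M *ᵥ v = x := by rw [hv, Matrix.mulVec_mulVec, Matrix.mul_nonsing_inv M hdet, Matrix.one_mulVec]
  have hdiag : ∀ B : Matrix ι ι ℝ, B p p = x ⬝ᵥ (B *ᵥ x) := by
    intro B
    rw [hx, Matrix.mulVec_single_one, single_one_dotProduct]
    rfl
  have h1 : M⁻¹ p p = 2 * (x ⬝ᵥ v) - v ⬝ᵥ (M *ᵥ v) := by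
    rw [hdiag M⁻¹, ← hv, hMv, dotProduct_comm v x]; ring
  rw [h1, hdiag M'⁻¹]
  calc 2 * (x ⬝ᵥ v) - v ⬝ᵥ (M *ᵥ v) ≤ 2 * (x ⬝ᵥ v) - v ⬝ᵥ (M' *ᵥ v) := by linarith [h v]
    _ ≤ x ⬝ᵥ (M'⁻¹ *ᵥ x) := two_mul_dotProduct_sub_quadForm_le hM' x v

end TwoFormGauss

end Summit.QuantumFields.YangMills.Theorems.AllWindowsColdBoxBoxHighLine
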